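/-
Copyright: the b2b-balaban T⁴-continuum CRUX team, row NE7b OWNER lineage `t4-ne7b-p1` (gen 126). Project licence.
-/
import Summits.QuantumFields.BalabanUV.T4Continuum.Spine.NE7b.SupZdCouplingTransferSolvability

/-!
# THE COMPACTNESS STEP OF THE COUPLING WINDOW: a property of couplings that holds NEAR every point of a compact window with a
# point-dependent constant, and is monotone in the constant, holds on the WHOLE window with ONE constant (finite subcover); and
# (264)'s two thresholds ARE such a neighbourhood — for reference constants `C_Ψ, C_G ≥ 0` the radius
# `ρ = min(1∕(2(C_G+1)), 1∕(2(e^{2νd}K_1K_{μ−ν}C_Ψ+1)))` is positive and `|a′ − a| < ρ` implies both thresholds.  With the window step this is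
# the scheme for UNIFORM constants over (255)'s window `[a(1 − 2^{−d}), a] ⊇ (a(1 − (n+1)^{−d}), a]` for ALL meshes at once: the package at
# each coupling of the window (from (213)∕(216)∕(222)∕(237) there, constants uniform in `n`) + (264) on a ball + this file (row NE7b, node
# U5c; (263) imported for the closure, (264) is the step it serves; [folklore] — Heine–Borel)

Cell `pub-balaban`, sub-cell `t4`, spine estimate NE7b (`T4WeightBudget.RelWeightBound`; the cell's OWN estimate — NOT PRINTED in
[Bałaban 1983–89], NOT PROVED).  Crux-route work under `Spine/NE7b/` by the row OWNER (`t4-ne7b-p1` gen 126, file (266)) under FREEZE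
(0)'s crux-prover clause, on § [NE7bP1-G125-HANDOFF] NEXT (3)(a) (the a-uniformity audit — the covering scheme); NOTHING of Bałaban's is
named as a Lean object, valued or asserted; no `T4Continuum/Support` leaf typed; no `def`, no notation (the package is an ARBITRARY predicate
`Q c κ` monotone in one size parameter `κ` — every constant of (264)'s package is a monotone function of such a `κ`); zero `sorry`.  Imports
(BY NAME): the OWNER's (263) `…SupZdCouplingTransferSolvability` (import closure only; (264) `…SupZdCouplingWindowStep` is the theorem whose thresholds §2 reads, not imported); Mathlib's `isCompact_Icc`, `IsCompact.elim_finite_subcover`,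
`Metric.isOpen_ball`, `Finset.single_le_sum`.

WHY (located).  (264) propagates the column's package from a coupling to a ball around it whose radius is explicit in the package's
constants; the constants double per step, so chaining steps from ONE base reaches only a bounded distance (`< 1∕C_G`-type), which covers
(255)'s window `(a(1 − (n+1)^{−d}), a]` for all meshes beyond some `n₀` but not for the finitely many small ones.  The remedy is not more
chaining but more bases: at EVERY coupling `c` of the compact window `[a(1 − 2^{−d}), a]` the reference theorems give the package with
constants depending on `c` (uniformly in `n`), (264) spreads it over a ball of radius `ρ(c) > 0` with controlled constants, and Heine–Borel
picks finitely many balls — ONE set of constants for the whole window and all meshes (existential, as uniformity requires; explicit on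
each ball).  §1 is that covering argument for an abstract monotone predicate; §2 shows (264)'s thresholds define such balls.

WHAT IS PROVED ([folklore]):
* §1 **`exists_uniform_constant`** (`Q : ℝ → ℝ → Prop` monotone in `κ`; near every `c ∈ [lo, hi]` some `κ` works on a ball ⟹ one `κ`
  works on `[lo, hi]`).
* §2 **`window_radius`** (for `C_Ψ, C_G ≥ 0`, rates `ν < μ`: `ρ > 0` explicit with `|a′ − a| < ρ` ⟹ (264)'s two thresholds
  `e^{νd}K_1·(|a′−a|C_Ψe^{νd}K_{μ−ν}) ≤ 1∕2` and `|a′−a|C_G ≤ 1∕2`).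
* §3 toy.

HONEST (what this is NOT).  Topology and arithmetic only; the instantiation (the package at every coupling of the window from
(213)∕(216)∕(222)∕(237), the encoding of its constants as monotone functions of one `κ`, and the final uniform statement) is the successor's
file; the uniform constant is EXISTENTIAL (a finite maximum over unnamed centres); scalar skeleton ((A3), NC-NE7b-α UNRULED); nothing of the
torus; nothing of Bałaban's asserted.  BY-NAME EFFECT ON THE WALL: NONE.  NE7b NOT PRINTED ∕ NOT PROVED; spine PROVED 0∕9; rung (B)+1 — the
programme's measures remain FINITE-torus statements; NOT the mass gap, NOT Clay.  HONEST DEPENDENCY: continuum YM on T⁴ ⇐ BetaPertH ∧ nine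
spine estimates (0∕9 proved); BetaPertH ⇐ (D1) ∧ (D4) ∧ CAP+tail; G-an2-4 gates asym, D1 and NE2∕3∕4.
-/

set_option autoImplicit false

noncomputable section

namespace Summit.QuantumFields.BalabanUV.T4Continuum.NE7b.SupZdCouplingWindowCover

open Real Filter Topology

/-! ## §1. Heine–Borel: locally uniform and monotone ⟹ uniform -/

/-- **ONE CONSTANT ON THE WHOLE WINDOW**: if `Q c κ` is monotone in `κ` and every `c ∈ [lo, hi]` has a ball on which some `κ` works, then one
`κ` works on all of `[lo, hi]` — a finite subcover of the compact interval and the largest of the finitely many constants. [folklore] -/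
theorem exists_uniform_constant {lo hi : ℝ} (Q : ℝ → ℝ → Prop) (hmono : ∀ c κ κ', Q c κ → κ ≤ κ' → Q c κ')
    (hloc : ∀ c ∈ Set.Icc lo hi, ∃ ρ κ : ℝ, 0 < ρ ∧ ∀ c', |c' - c| < ρ → Q c' κ) :
    ∃ κ : ℝ, ∀ c ∈ Set.Icc lo hi, Q c κ := by
  classical
  -- choose radii and constants at every point of the window
  have hloc' : ∀ c : Set.Icc lo hi, ∃ ρ κ : ℝ, 0 < ρ ∧ ∀ c', |c' - (c : ℝ)| < ρ → Q c' κ := fun c => hloc c c.2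
  choose ρ κ hρ hQ using hloc'
  -- the balls cover the compact window
  have hcover : Set.Icc lo hi ⊆ ⋃ c : Set.Icc lo hi, Metric.ball (c : ℝ) (ρ c) := by
    intro x hx
    refine Set.mem_iUnion.2 ⟨⟨x, hx⟩, ?_⟩
    rw [Metric.mem_ball, dist_self]
    exact hρ ⟨x, hx⟩
  obtain ⟨t, ht⟩ := isCompact_Icc.elim_finite_subcover (fun c : Set.Icc lo hi => Metric.ball (c : ℝ) (ρ c))
    (fun c => Metric.isOpen_ball) hcover
  -- the largest constant (made nonnegative so that a sum dominates each term)
  refine ⟨∑ c ∈ t, max (κ c) 0, fun x hx => ?_⟩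
  obtain ⟨c, hct, hxc⟩ : ∃ c ∈ t, x ∈ Metric.ball (c : ℝ) (ρ c) := by
    have h := ht hx
    simp only [Set.mem_iUnion] at h
    obtain ⟨c, hct, hxc⟩ := h
    exact ⟨c, hct, hxc⟩
  have hQx : Q x (κ c) := hQ c x (by rw [Metric.mem_ball, Real.dist_eq] at hxc; exact hxc)
  have hle : κ c ≤ ∑ c' ∈ t, max (κ c') 0 :=
    (le_max_left (κ c) 0).trans (Finset.single_le_sum (f := fun c' => max (κ c') 0) (fun c' _ => le_max_right _ _) hct)
  exact hmono x (κ c) _ hQx hle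

/-! ## §2. The window step's thresholds define a ball -/

/-- **THE RADIUS OF THE WINDOW STEP**: for `C_Ψ, C_G ≥ 0` and rates `ν < μ`, with `L = e^{νd}K_1·e^{νd}K_{μ−ν}` and
`ρ = min(1∕(2(C_G + 1)), 1∕(2(LC_Ψ + 1)))`: `0 < ρ`, and `|a′ − a| < ρ` implies both thresholds of (264),
`e^{νd}K_1·(|a′−a|C_Ψe^{νd}K_{μ−ν}) ≤ 1∕2` and `|a′−a|C_G ≤ 1∕2`. [folklore] -/
theorem window_radius (d : ℕ) {μ ν CΨ CG : ℝ} (hνμ : ν < μ) (hCΨ : 0 ≤ CΨ) (hCG : 0 ≤ CG) :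
    ∃ ρ : ℝ, 0 < ρ ∧ ∀ a a' : ℝ, |a' - a| < ρ →
      (exp (ν * d) * (2 * (1 - exp (-1))⁻¹) ^ d) * (|a' - a| * CΨ * exp (ν * d) * (2 * (1 - exp (-(μ - ν)))⁻¹) ^ d) ≤ 1 / 2 ∧
      |a' - a| * CG ≤ 1 / 2 := by
  have hK1 : 0 ≤ (2 * (1 - exp (-1 : ℝ))⁻¹) ^ d :=
    pow_nonneg (mul_nonneg zero_le_two (inv_nonneg.2 (sub_nonneg.2 (exp_le_one_iff.2 (by norm_num))))) d
  have hK2 : 0 ≤ (2 * (1 - exp (-(μ - ν))))⁻¹ ^ d :=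
    pow_nonneg (inv_nonneg.2 (mul_nonneg zero_le_two (sub_nonneg.2 (exp_le_one_iff.2 (by linarith))))) d
  obtain ⟨L, hL⟩ : ∃ L : ℝ, L = (exp (ν * d) * (2 * (1 - exp (-1))⁻¹) ^ d) * (CΨ * exp (ν * d) * (2 * (1 - exp (-(μ - ν)))⁻¹) ^ d) :=
    ⟨_, rfl⟩
  have hK2' : 0 ≤ (2 * (1 - exp (-(μ - ν)))⁻¹) ^ d :=
    pow_nonneg (mul_nonneg zero_le_two (inv_nonneg.2 (sub_nonneg.2 (exp_le_one_iff.2 (by linarith))))) d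
  have hL0 : 0 ≤ L := by rw [hL]; positivity
  refine ⟨min (1 / (2 * (CG + 1))) (1 / (2 * (L + 1))), lt_min (by positivity) (by positivity), fun a a' hε => ?_⟩
  have hε0 : 0 ≤ |a' - a| := abs_nonneg _
  have h1 : |a' - a| < 1 / (2 * (CG + 1)) := lt_of_lt_of_le hε (min_le_left _ _)
  have h2 : |a' - a| < 1 / (2 * (L + 1)) := lt_of_lt_of_le hε (min_le_right _ _)
  constructor
  · -- the column threshold: `L·|ε| ≤ L∕(2(L+1)) ≤ 1∕2`
    have e : (exp (ν * d) * (2 * (1 - exp (-1))⁻¹) ^ d) * (|a' - a| * CΨ * exp (ν * d) * (2 * (1 - exp (-(μ - ν)))⁻¹) ^ d)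
        = L * |a' - a| := by rw [hL]; ring
    rw [e]
    have h3 : L * |a' - a| ≤ L * (1 / (2 * (L + 1))) := mul_le_mul_of_nonneg_left h2.le hL0
    have h4 : L * (1 / (2 * (L + 1))) ≤ 1 / 2 := by
      rw [mul_one_div, div_le_div_iff₀ (by positivity) (by norm_num)]
      nlinarith
    exact h3.trans h4
  · -- the solvability threshold: `C_G|ε| ≤ C_G∕(2(C_G+1)) ≤ 1∕2`
    have h3 : |a' - a| * CG ≤ 1 / (2 * (CG + 1)) * CG := mul_le_mul_of_nonneg_right h1.le hCG
    have h4 : 1 / (2 * (CG + 1)) * CG ≤ 1 / 2 := by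
      rw [one_div_mul_eq_div, div_le_div_iff₀ (by positivity) (by norm_num)]
      nlinarith
    exact h3.trans h4

/-! ## §3. Toy -/

/-- Toy: a predicate that holds everywhere with the constant `|c|` (and is monotone) holds on `[0, 1]` with one constant. -/
example : ∃ κ : ℝ, ∀ c ∈ Set.Icc (0 : ℝ) 1, |c| ≤ κ :=
  exists_uniform_constant (fun c κ => |c| ≤ κ) (fun _ _ _ h h' => h.trans h') fun c _ =>
    ⟨1, |c| + 1, one_pos, fun c' hc' => by
      have := abs_sub_abs_le_abs_sub c' c
      linarith⟩

end Summit.QuantumFields.BalabanUV.T4Continuum.NE7b.SupZdCouplingWindowCover
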